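import Literature.Topology.FourManifolds.SlideReshapeLowerIsotopy
import HarnessLib

/-!
# Reshaping the lower arch: tracks that may linger on the left edge

Topic `Literature/Topology/FourManifolds`; fact seat `provefact-IsStrictHandleSlide.isSurgery`
(R. C. Kirby, *The Topology of 4-Manifolds*, LNM 1374 (1989), Ch. I §4; remaining content: the
named fact (S) `Literature.Topology.FourManifolds.FramedLink.IsStrictHandleSlide.slideModel`).
Variant of `SlideReshapeLower.planarFamily_lowerTrack` / `SlideReshapeLowerIsotopy`: the
admissible second track of the actual construction (`K2Track.lean`) stays on the left edge
(`X₁ = 0`, height `fLo`) slightly beyond `alo + ε` before rising, so the hypothesis "`X₁ > 0` right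
after `alo + ε`" is replaced by "`X₁ s = 0` on `S` implies `H₁ s = fLo s`": such a track point is the
point of `A` at the same parameter, which is not a point of the rebuilt circle off `S`. Proved here
(no definitions, no named facts):

* `BandCore.false_of_typeA'`, `BandCore.planarFamily_lowerTrack'`,
  `BandCore.exists_ambientIsotopy_lowerTrack'`.

## References

* R. C. Kirby, *The Topology of 4-Manifolds*, LNM 1374, Springer (1989), Ch. I §4. [Kirby1989]
* M. W. Hirsch, *Differential Topology* (1976), Ch. 8 §1, Thm. 1.3. [HirschDT1976]
-/

open scoped Manifold ContDiff Topology Real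
open Function Set Metric

noncomputable section

namespace Literature.Topology.FourManifolds

namespace BandCore

variable {A B : Knot} {avoid : Set (Metric.sphere (0 : EuclideanSpace ℝ (Fin 4)) 1)} (c : BandCore A B avoid)

/-- Disjointness, type A parameters, for track points on the left edge at height `fLo s`: such a
point is `A (circlePt s)`, and `s ∈ S` while `t ∉ S`. [folklore] -/
theorem false_of_typeA' {x : EuclideanSpace ℝ (Fin 2)} (hxsq : x ∈ squareNhd c.δ)
    {s t : ℝ} (hs : s ∈ Icc (c.alo + c.epsLo / 2) (c.tlo - c.epsLo / 4)) (ht : t ∈ Ico c.alo (c.alo + 1))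
    (hts : t ∉ Icc (c.alo + c.epsLo / 2) (c.tlo - c.epsLo / 4))
    (hA : t ≤ c.alo + c.epsLo ∨ c.ahi - c.epsHi ≤ t)
    (hleft : x 0 = 0 → x 1 = c.fLo s)
    (he : ((c.band x : Metric.sphere (0 : EuclideanSpace ℝ (Fin 4)) 1) : EuclideanSpace ℝ (Fin 4)) = c.pieceFun t) : False := by
  have hm := c.marks_lt
  have hε := c.epsLo_bounds.1
  rw [c.pieceFun_typeA ht hA, Knot.curve_apply] at he
  have hmem : c.band x ∈ range ⇑A := ⟨circlePt t, (Subtype.ext he).symm⟩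
  have hx00 : x 0 = 0 := by
    by_contra h; exact c.band_not_mem_range_A hxsq h hmem
  have hx1 := hleft hx00
  have hxeq : x = pt2 0 (c.fLo s) := by
    ext i; fin_cases i
    · exact hx00
    · exact hx1
  have hsI : s ∈ Icc (c.thetaA (3 / 20)) c.tlo := ⟨by linarith [hs.1, hm.2.1], by linarith [hs.2]⟩
  have hsI' : s ∈ Icc (c.thetaA 10⁻¹) (c.thetaA (9 / 10)) :=
    ⟨by linarith [hs.1, hm.1, hm.2.1], by linarith [hs.2, hm.2.2.2.1, hm.2.2.2.2.1, hm.2.2.2.2.2.1, hm.2.2.2.2.2.2.1]⟩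
  rw [hxeq, (c.fLo_eq_heightA hsI).1, c.band_pt2_zero_heightA hsI'] at he
  have hst : circlePt s = circlePt t := A.injective (Subtype.ext he)
  obtain ⟨n, hn⟩ := circlePt_eq_circlePt_iff.1 hst
  have htlo1 : c.tlo < c.alo + 1 := by
    linarith [hm.2.2.2.1, hm.2.2.2.2.1, hm.2.2.2.2.2.1, hm.2.2.2.2.2.2.1, hm.2.2.2.2.2.2.2]
  have hn1 : (n : ℝ) < 1 := by linarith [ht.1, hs.2]
  have hn2 : (-1 : ℝ) < n := by linarith [ht.2, hs.1]
  have hn1' : n < 1 := by exact_mod_cast hn1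
  have hn2' : -1 < n := by exact_mod_cast hn2
  obtain rfl : n = 0 := by omega
  simp only [Int.cast_zero, add_zero] at hn
  exact hts (hn ▸ hs)

/-- **The planar family reshaping the lower arch (tracks that may linger on the left edge).** Variant of
`planarFamily_lowerTrack` in which the positivity of `X₁` right after `alo + ε` is replaced by:
wherever `X₁` vanishes on `S`, the height is `fLo` (the track is then the point of `A` at that
parameter). See the module docstring; the parameters of
the family are `a = alo`, `ε_f = min (ε/2) (alo + 1 - tlo)`, `S = [alo + ε/2, tlo - ε/4]`, inner
interval `(alo + ε, tlo - ε/2)`, `ε = epsLo`. [cite: HirschDT1976, Ch. 8 §1, Thm. 1.3] -/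
theorem planarFamily_lowerTrack' (hAB : Disjoint (range ⇑A) (range ⇑B)) {X₁ H₁ : ℝ → ℝ}
    (hX₁s : ContDiff ℝ ∞ X₁) (hH₁s : ContDiff ℝ ∞ H₁)
    (hagreeX : ∀ t, t ∉ Ioo (c.alo + c.epsLo) (c.tlo - c.epsLo / 2) → X₁ t = c.cLo t 0)
    (hagreeH : ∀ t, t ∉ Ioo (c.alo + c.epsLo) (c.tlo - c.epsLo / 2) → H₁ t = c.cLo t 1)
    (hX₁I : ∀ t, X₁ t ∈ Icc (0 : ℝ) 1) (hdX₁ : ∀ t, 0 ≤ deriv X₁ t)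
    (hX₁zero : ∀ s ∈ Icc (c.alo + c.epsLo / 2) (c.tlo - c.epsLo / 4), X₁ s = 0 → H₁ s = c.fLo s)
    (hX₁lt : ∀ t, t < c.tlo - 2 * c.epsLo → X₁ t < 1)
    (hH₁I : ∀ t ∈ Icc (c.alo + c.epsLo / 2) (c.tlo - c.epsLo / 4), H₁ t ∈ Ioo (10⁻¹ : ℝ) 2⁻¹)
    (hH₁ge : ∀ t ∈ Icc (c.tlo - 2 * c.epsLo) (c.tlo - c.epsLo / 4), X₁ t = 1 → c.gLo t ≤ H₁ t)
    (hinj₁ : InjOn (fun t ↦ (pt2 (X₁ t) (H₁ t) : EuclideanSpace ℝ (Fin 2))) (Icc (c.alo + c.epsLo / 2) (c.tlo - c.epsLo / 4)))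
    (hreg₁ : ∀ s ∈ Icc (c.alo + c.epsLo / 2) (c.tlo - c.epsLo / 4), deriv X₁ s = 0 → deriv H₁ s ≠ 0)
    (hco : ∀ t ∈ Icc (c.alo + c.epsLo / 2) (c.tlo - c.epsLo / 4), ∀ t' ∈ Icc (c.alo + c.epsLo / 2) (c.tlo - c.epsLo / 4),
      t < t' → c.cLo t 0 = c.cLo t' 0 → X₁ t = X₁ t' →
      (c.cLo t 1 < c.cLo t' 1 ∧ H₁ t < H₁ t') ∨ (c.cLo t' 1 < c.cLo t 1 ∧ H₁ t' < H₁ t))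
    (hcoD : ∀ s ∈ Icc (c.alo + c.epsLo / 2) (c.tlo - c.epsLo / 4),
      deriv (fun t ↦ c.cLo t 0) s = 0 → deriv X₁ s = 0 → 0 < deriv (fun t ↦ c.cLo t 1) s * deriv H₁ s) :
    (c.rebuildData hAB).PlanarFamily (c.rebuild hAB) c.alo (min (c.epsLo / 2) (c.alo + 1 - c.tlo))
      (c.alo + c.epsLo / 2) (c.alo + c.epsLo) (c.tlo - c.epsLo / 2) (c.tlo - c.epsLo / 4)
      (fun u t ↦ pt2 ((1 - u) * c.cLo t 0 + u * X₁ t) ((1 - u) * c.cLo t 1 + u * H₁ t)) := by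
  -- basic parameter facts
  have hm := c.marks_lt
  obtain ⟨hε, hε5, hεlam⟩ := c.epsLo_bounds
  have hat : c.alo + 2 * c.epsLo < c.tlo - 2 * c.epsLo := c.alo_add_lt_tlo_sub
  have htlo1 : c.tlo < c.alo + 1 := by
    linarith [hm.2.2.2.1, hm.2.2.2.2.1, hm.2.2.2.2.2.1, hm.2.2.2.2.2.2.1, hm.2.2.2.2.2.2.2]
  have hδ := c.δ_pos
  set ε := c.epsLo with hεdef
  -- the first track `cLo` in coordinates
  have hX₀s : ContDiff ℝ ∞ (fun t ↦ c.cLo t 0) := by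
    rw [show (fun t ↦ c.cLo t 0) = smoothStep (c.alo + ε) (c.tlo - ε) from funext fun t ↦ c.cLo_apply_zero t]
    exact contDiff_smoothStep _ _
  have hH₀s : ContDiff ℝ ∞ (fun t ↦ c.cLo t 1) := (contDiff_euclidean.1 c.cLo_spec.1) 1
  have hpt : ∀ t, (pt2 (c.cLo t 0) (c.cLo t 1) : EuclideanSpace ℝ (Fin 2)) = c.cLo t := fun t ↦ by
    ext i; fin_cases i <;> rfl
  refine BandData.planarFamily_convex (c.rebuildData hAB) (lt_min (by linarith) (by linarith))
    ⟨by simp only [hεdef]; linarith [min_le_left (c.epsLo / 2) (c.alo + 1 - c.tlo)], by linarith, by linarith, by linarith,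
      by linarith [min_le_right (c.epsLo / 2) (c.alo + 1 - c.tlo)]⟩
    hX₀s hX₁s hH₀s hH₁s hagreeX hagreeH (fun s hs ↦ ?_) (fun s hs ↦ ?_) (fun s hs ↦ ?_)
    (fun s _ ↦ c.deriv_cLo_fst_nonneg s) (fun s _ ↦ hdX₁ s) (fun t ht t' ht' he ↦ ?_) hinj₁ hco
    (fun s _ h0 ↦ ?_) hreg₁ hcoD (fun u hu s hs t ht hts ↦ ?_)
  · -- curve_eq: on `S ⊆ [alo, tlo)` the knot is `band (cLo s)`
    rw [hpt, rebuildData_band]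
    exact c.curve_rebuild_eq_band_cLo hAB ⟨by linarith [hs.1], by linarith [hs.2]⟩
  · -- mem₀
    rw [hpt, rebuildData_δ]
    exact (c.cLo_mem ⟨by linarith [hs.1], by linarith [hs.2]⟩).1
  · -- mem₁
    rw [rebuildData_δ]
    intro i
    fin_cases i
    · show X₁ s ∈ Ioo (-c.δ) (1 + c.δ)
      exact ⟨by linarith [(hX₁I s).1], by linarith [(hX₁I s).2]⟩
    · show H₁ s ∈ Ioo (-c.δ) (1 + c.δ)
      have h := hH₁I s hs
      exact ⟨by linarith [h.1], by linarith [h.2]⟩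
  · -- injectivity of the first track (from the global injectivity of `cLo`)
    have he' : c.cLo t = c.cLo t' := by simpa only [hpt] using he
    exact c.cLo_spec.2.2.2.2.2.2.1 he'
  · -- regularity of the first track: `deriv cLo s = (deriv X₀ s, deriv H₀ s) ≠ 0`
    intro h1
    apply c.cLo_spec.2.2.2.2.2.2.2 s
    have hX₀d : HasDerivAt (fun t ↦ c.cLo t 0) (deriv (fun t ↦ c.cLo t 0) s) s :=
      ((hX₀s.differentiable (by simp)) s).hasDerivAt
    have hH₀d : HasDerivAt (fun t ↦ c.cLo t 1) (deriv (fun t ↦ c.cLo t 1) s) s :=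
      ((hH₀s.differentiable (by simp)) s).hasDerivAt
    have hc := hasDerivAt_pt2 hX₀d hH₀d
    have hfun : (fun t ↦ (pt2 (c.cLo t 0) (c.cLo t 1) : EuclideanSpace ℝ (Fin 2))) = c.cLo := funext hpt
    rw [hfun] at hc
    rw [hc.deriv, h0, h1]
    ext i; fin_cases i <;> rfl
  · -- disjointness from the rest of `K♮`
    intro he
    set x : EuclideanSpace ℝ (Fin 2) := pt2 ((1 - u) * c.cLo s 0 + u * X₁ s) ((1 - u) * c.cLo s 1 + u * H₁ s) with hx
    have hsI : s ∈ Icc c.alo c.tlo := ⟨by linarith [hs.1], by linarith [hs.2]⟩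
    have hx0 : x 0 = (1 - u) * c.cLo s 0 + u * X₁ s := rfl
    have hx1 : x 1 = (1 - u) * c.cLo s 1 + u * H₁ s := rfl
    have hc0 := c.cLo_fst_mem_Icc s
    have hc1 : c.cLo s 1 ∈ Ioo (10⁻¹ : ℝ) (2 / 5) := (c.cLo_mem hsI).2
    have hX := hX₁I s
    have hH := hH₁I s hs
    have hx0I : x 0 ∈ Icc (0 : ℝ) 1 := by
      rw [hx0]
      have a1 := mul_nonneg hu.1 hX.1
      have a2 := mul_nonneg (sub_nonneg.2 hu.2) hc0.1
      have a3 := mul_nonneg (sub_nonneg.2 hu.2) (sub_nonneg.2 hc0.2)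
      have a4 := mul_nonneg hu.1 (sub_nonneg.2 hX.2)
      constructor <;> nlinarith
    have hx1I : x 1 ∈ Ioo (10⁻¹ : ℝ) 2⁻¹ := by
      rw [hx1]; exact convex_mem_Ioo ⟨hc1.1, by linarith [hc1.2]⟩ hH hu
    have hxsq : x ∈ squareNhd c.δ := by
      intro i; fin_cases i
      · show x 0 ∈ Ioo (-c.δ) (1 + c.δ); exact ⟨by linarith [hx0I.1], by linarith [hx0I.2]⟩
      · show x 1 ∈ Ioo (-c.δ) (1 + c.δ); exact ⟨by linarith [hx1I.1], by linarith [hx1I.2]⟩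
    rw [rebuildData_band] at he
    rw [c.curve_rebuild_eq_pieceFun hAB ht] at he
    rcases c.kind_cases t with hA | hB | hO | hO
    · refine c.false_of_typeA' hxsq hs ht hts hA (fun hx00 ↦ ?_) he
      -- `x 0 = 0`: the height is `fLo s`
      rw [hx0] at hx00
      have ha : 0 ≤ (1 - u) * c.cLo s 0 := mul_nonneg (sub_nonneg.2 hu.2) hc0.1
      have hb : 0 ≤ u * X₁ s := mul_nonneg hu.1 hX.1
      have ha0 : (1 - u) * c.cLo s 0 = 0 := by linarith
      have hb0 : u * X₁ s = 0 := by linarith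
      rw [hx1]
      rcases hu.1.eq_or_lt with hu0 | hu0
      · -- `u = 0`: `cLo s 0 = 0` forces `s ≤ alo + ε`, where `cLo s 1 = fLo s`
        rw [← hu0] at ha0 ⊢
        simp only [sub_zero, one_mul] at ha0
        have hsle : s ≤ c.alo + ε := by
          by_contra hlt; push Not at hlt
          have h1 : 0 < c.cLo s 0 := by
            rw [c.cLo_apply_zero]
            rcases lt_or_ge s (c.tlo - ε) with h | h
            · exact (smoothStep_mem_Ioo (by linarith) ⟨hlt, h⟩).1
            · rw [smoothStep_of_ge (by linarith) h]; exact one_pos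
          linarith
        rw [c.cLo_snd_eq_fLo_of_le (by linarith)]; ring
      rcases hu.2.eq_or_lt with hu1 | hu1
      · -- `u = 1`: `X₁ s = 0`
        rw [hu1] at hb0 ⊢
        simp only [one_mul] at hb0
        rw [hX₁zero s hs hb0]; ring
      · -- `0 < u < 1`: both vanish
        have h1 : c.cLo s 0 = 0 := by
          rcases mul_eq_zero.1 ha0 with h | h
          · exact absurd h (by linarith)
          · exact h
        have h2 : X₁ s = 0 := by
          rcases mul_eq_zero.1 hb0 with h | h
          · exact absurd h hu0.ne'
          · exact h
        have hsle : s ≤ c.alo + ε := by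
          by_contra hlt; push Not at hlt
          have : 0 < c.cLo s 0 := by
            rw [c.cLo_apply_zero]
            rcases lt_or_ge s (c.tlo - ε) with h | h
            · exact (smoothStep_mem_Ioo (by linarith) ⟨hlt, h⟩).1
            · rw [smoothStep_of_ge (by linarith) h]; exact one_pos
          linarith
        rw [c.cLo_snd_eq_fLo_of_le (by linarith), hX₁zero s hs h2]; ring
    · refine c.false_of_typeB hxsq hx1I hs hts hB (fun hx01 ↦ ?_) he
      -- `x 0 = 1` forces `s ≥ tlo - 2ε` and the height bound
      have hsge : c.tlo - 2 * ε ≤ s := by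
        by_contra hlt; push Not at hlt
        have h1 : c.cLo s 0 < 1 := by
          rw [c.cLo_apply_zero]
          rcases le_or_gt s (c.alo + ε) with h | h
          · rw [smoothStep_of_le (by linarith) h]; norm_num
          · exact (smoothStep_mem_Ioo (by linarith) ⟨h, by linarith⟩).2
        have h2 : X₁ s < 1 := hX₁lt s hlt
        have : x 0 < 1 := by
          rw [hx0]
          have ha : 0 ≤ (1 - u) * (1 - c.cLo s 0) := mul_nonneg (sub_nonneg.2 hu.2) (sub_nonneg.2 h1.le)
          have hb : 0 ≤ u * (1 - X₁ s) := mul_nonneg hu.1 (sub_nonneg.2 h2.le)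
          rcases hu.1.eq_or_lt with hu0 | hu0
          · rw [← hu0]; linarith
          · have : 0 < u * (1 - X₁ s) := mul_pos hu0 (sub_pos.2 h2); nlinarith
        linarith
      refine ⟨hsge, ?_⟩
      have hv : c.cLo s 1 = c.gLo s := c.cLo_snd_eq_gLo_of_ge hsge
      rcases hu.1.eq_or_lt with hu0 | hu0
      · rw [hx1, ← hu0, hv]; simp
      · have hX1 : X₁ s = 1 := by
          have h1 : c.cLo s 0 ≤ 1 := hc0.2
          have h2 : X₁ s ≤ 1 := hX.2
          rw [hx0] at hx01
          have ha : 0 ≤ (1 - u) * (1 - c.cLo s 0) := mul_nonneg (sub_nonneg.2 hu.2) (sub_nonneg.2 h1)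
          have hb : 0 ≤ u * (1 - X₁ s) := mul_nonneg hu.1 (sub_nonneg.2 h2)
          have hsum : (1 - u) * (1 - c.cLo s 0) + u * (1 - X₁ s) = 0 := by linarith
          have hb0 : u * (1 - X₁ s) = 0 := by linarith
          rcases mul_eq_zero.1 hb0 with h | h
          · exact absurd h hu0.ne'
          · linarith
        have hH1 := hH₁ge s ⟨hsge, hs.2⟩ hX1
        have hpos : 0 ≤ u * (H₁ s - c.gLo s) := mul_nonneg hu.1 (sub_nonneg.2 hH1)
        rw [hx1, hv]; linarith
    · -- type O (lower arch): impossible, these parameters lie in `S`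
      exact hts ⟨by linarith [hO.1], by linarith [hO.2]⟩
    · exact c.false_of_typeO_hi hxsq hx1I.2 hO he

/-- **The reshaping isotopy of the lower arch** (variant for tracks lingering on the left edge). Under the hypotheses of
`planarFamily_lowerTrack`, for every open `O ⊆ S³` containing all band images
`band ((1-u) cLo s + u (X₁ s, H₁ s))`, `u ∈ [0, 1]`, `s ∈ S`, there are an ambient isotopy `Θ` of
`S³`, stationary off `O`, and a knot `k₂` with `Θ 1 ∘ K♮ = k₂`, `k₂ (circlePt s) = band (X₁ s, H₁ s)`
for `s ∈ S` and `k₂ (circlePt t) = K♮ (circlePt t)` for `t ∈ [alo, alo + 1) ∖ S`.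
[cite: HirschDT1976, Ch. 8 §1, Thm. 1.3] -/
theorem exists_ambientIsotopy_lowerTrack' (hAB : Disjoint (range ⇑A) (range ⇑B)) {X₁ H₁ : ℝ → ℝ}
    (hX₁s : ContDiff ℝ ∞ X₁) (hH₁s : ContDiff ℝ ∞ H₁)
    (hagreeX : ∀ t, t ∉ Ioo (c.alo + c.epsLo) (c.tlo - c.epsLo / 2) → X₁ t = c.cLo t 0)
    (hagreeH : ∀ t, t ∉ Ioo (c.alo + c.epsLo) (c.tlo - c.epsLo / 2) → H₁ t = c.cLo t 1)
    (hX₁I : ∀ t, X₁ t ∈ Icc (0 : ℝ) 1) (hdX₁ : ∀ t, 0 ≤ deriv X₁ t)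
    (hX₁zero : ∀ s ∈ Icc (c.alo + c.epsLo / 2) (c.tlo - c.epsLo / 4), X₁ s = 0 → H₁ s = c.fLo s)
    (hX₁lt : ∀ t, t < c.tlo - 2 * c.epsLo → X₁ t < 1)
    (hH₁I : ∀ t ∈ Icc (c.alo + c.epsLo / 2) (c.tlo - c.epsLo / 4), H₁ t ∈ Ioo (10⁻¹ : ℝ) 2⁻¹)
    (hH₁ge : ∀ t ∈ Icc (c.tlo - 2 * c.epsLo) (c.tlo - c.epsLo / 4), X₁ t = 1 → c.gLo t ≤ H₁ t)
    (hinj₁ : InjOn (fun t ↦ (pt2 (X₁ t) (H₁ t) : EuclideanSpace ℝ (Fin 2))) (Icc (c.alo + c.epsLo / 2) (c.tlo - c.epsLo / 4)))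
    (hreg₁ : ∀ s ∈ Icc (c.alo + c.epsLo / 2) (c.tlo - c.epsLo / 4), deriv X₁ s = 0 → deriv H₁ s ≠ 0)
    (hco : ∀ t ∈ Icc (c.alo + c.epsLo / 2) (c.tlo - c.epsLo / 4), ∀ t' ∈ Icc (c.alo + c.epsLo / 2) (c.tlo - c.epsLo / 4),
      t < t' → c.cLo t 0 = c.cLo t' 0 → X₁ t = X₁ t' →
      (c.cLo t 1 < c.cLo t' 1 ∧ H₁ t < H₁ t') ∨ (c.cLo t' 1 < c.cLo t 1 ∧ H₁ t' < H₁ t))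
    (hcoD : ∀ s ∈ Icc (c.alo + c.epsLo / 2) (c.tlo - c.epsLo / 4),
      deriv (fun t ↦ c.cLo t 0) s = 0 → deriv X₁ s = 0 → 0 < deriv (fun t ↦ c.cLo t 1) s * deriv H₁ s)
    {O : Set (Metric.sphere (0 : EuclideanSpace ℝ (Fin 4)) 1)} (hO : IsOpen O)
    (hOsub : ∀ u ∈ Icc (0 : ℝ) 1, ∀ s ∈ Icc (c.alo + c.epsLo / 2) (c.tlo - c.epsLo / 4),
      c.band (pt2 ((1 - u) * c.cLo s 0 + u * X₁ s) ((1 - u) * c.cLo s 1 + u * H₁ s)) ∈ O) :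
    ∃ (Θ : AmbientIsotopy (𝓡 3) (Metric.sphere (0 : EuclideanSpace ℝ (Fin 4)) 1)) (k₂ : Knot),
      (∀ t y, y ∉ O → Θ.toFun t y = y) ∧ Θ.toFun 1 ∘ ⇑(c.rebuild hAB) = ⇑k₂ ∧
      (∀ s ∈ Icc (c.alo + c.epsLo / 2) (c.tlo - c.epsLo / 4), k₂ (circlePt s) = c.band (pt2 (X₁ s) (H₁ s))) ∧
      (∀ t ∈ Ico c.alo (c.alo + 1), t ∉ Icc (c.alo + c.epsLo / 2) (c.tlo - c.epsLo / 4) →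
        k₂ (circlePt t) = c.rebuild hAB (circlePt t)) := by
  have hP := c.planarFamily_lowerTrack' hAB hX₁s hH₁s hagreeX hagreeH hX₁I hdX₁ hX₁zero hX₁lt hH₁I hH₁ge hinj₁ hreg₁ hco hcoD
  have hGO : ∀ y : Metric.sphere (0 : EuclideanSpace ℝ (Fin 4)) 1, y ∉ O → ∀ u ∈ Icc (0 : ℝ) 1,
      ∀ s ∈ Icc (c.alo + c.epsLo / 2) (c.tlo - c.epsLo / 4), (y : EuclideanSpace ℝ (Fin 4)) ≠ hP.fam u s := by
    intro y hy u hu s hs he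
    rw [hP.fam_of_mem u hs, rebuildData_band] at he
    have hmem := hOsub u hu s hs
    have : y = c.band (pt2 ((1 - u) * c.cLo s 0 + u * X₁ s) ((1 - u) * c.cLo s 1 + u * H₁ s)) := Subtype.ext he
    exact hy (this ▸ hmem)
  obtain ⟨Θ, hΘO, hΘ, -⟩ := hP.isModification.exists_ambientIsotopy hO hGO
  refine ⟨Θ, hP.outKnot, hΘO, hΘ 1 ⟨zero_le_one, le_rfl⟩, fun s hs ↦ ?_, fun t ht hts ↦ ?_⟩
  · rw [hP.outKnot_circlePt_of_mem hs, rebuildData_band]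
    simp
  · exact hP.outKnot_circlePt_of_not_mem ht hts

end BandCore

end Literature.Topology.FourManifolds
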